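import Summits.QuantumFields.YangMills.Theorems.UnitScaleTiltProp7CovBlockGauss
import Summits.QuantumFields.YangMills.Theorems.UnitScaleTiltProp7CovLineFaceTrace
import Summits.QuantumFields.YangMills.Theorems.UnitScaleTiltProp7BlockLineCount
import HarnessLib

/-!
# Route `UnitScaleTilt`, crux K1 «MinimiserStabilityRegPr» (stmt-QuantumFields-19200), route-R E′ S3 K-form engine, row (P′) ∕ hVH — «FAR-MASS» (px17 LOCATE §0.1 (F) by name):
# the mass of a bond field ON THE FAR LAYERS of the `k`-blocks is paid by the 1-D trace along the block lines: `Σ_y Σ_μ Σ_{r̄_μ+1 = L^k} ‖B⟨x_r̄, μ⟩‖² ≤ 2ℓ⁻¹·Σ_b‖B b‖² + 2ℓ·G_long,V(B)`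
# (✓ `Prop7CovLineFaceTrace.normSq_apply_le_line_trace` per line, the lines from the near layer partition the block ✓ `Prop7CovBlockGauss.sum_eq_sum_far_layer_lines`) — the payer of the junction's
# mass term in hVH's inhabitant (px15 LOCATE 01:32Z: without it the junction is short by one power of `ℓ`)

Cell `ym3-torus`, width seat `ym3-torus-px15` (gen 3); hXb∕hVH lane (★ym-ust-19200-p1 g16 WORD 10 (2), p1 g17 WORD 2).  THEOREMS ONLY (0 `def`, 0 `sorry`, 0 `instance`); `--supports stmt-QuantumFields-19200`,
count-neutral.  YM₃ on T³ is a ladder rung (R3), not the Clay problem; nothing here claims a stub, the crux, d = 4 or the mass gap.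

WHAT IS PROVED (ns `…Theorems.Prop7FarLayerMassTrace`; finest torus, level `k`, `h : sitesPerDir 0 = L^k·sitesPerDir k`, `M_N(ℂ)`, `V` `U1`-valued).
* `iterate_shift_nearLayer` (the `s`-th site of the line from the near-layer offset `r̄ with r̄_μ ↦ 0` is `x_{r̄ with r̄_μ ↦ s}`), ★★ `sum_far_normSq_le_block` (per block and direction:
  `Σ_{r̄ far} ‖f(x_r̄)‖² ≤ 2ℓ⁻¹·Σ_r ‖f(x_r)‖² + 2ℓ·Σ_r ‖R(V⟨x_r,μ⟩)f(x_r+e_μ) − f(x_r)‖²`, any site function `f`),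
  ★★★ `sum_far_layer_mass_le` (summed: `Σ_yΣ_μΣ_{far}‖B⟨x_r̄,μ⟩‖² ≤ 2ℓ⁻¹·Σ_b‖B b‖² + 2ℓ·Σ_b‖R(V_b)B(b+e_{μ_b}) − B b‖²`).
HONEST SCOPE.  Kinematics over two landed theorems; no curvature, no smallness.

References: T. Bałaban, CMP 95 (1984) 17–40 [Balaban1984PropagatorsI] ((1.18)–(1.21) pp.20–21); CMP 99 (1985) 75–102 [Balaban1985RegularSpaces] ((1.1) p.76); CMP 102 (1985) 277–309 [Balaban1985Variational] (Prop. 7 p.299).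
-/

set_option autoImplicit false

noncomputable section

open scoped BigOperators Matrix.Norms.L2Operator

namespace Summit.QuantumFields.YangMills.Theorems.Prop7FarLayerMassTrace

open Literature.MathematicalPhysics.QuantumFieldTheory.Balaban1983to89
open Finset
open B7Prop1Explicit (U1)
open B7Eq78Linearization (conjR)
open Summit.QuantumFields.YangMills.Theorems.Prop7CovLineFaceTrace (normSq_apply_le_line_trace)
open Summit.QuantumFields.YangMills.Theorems.Prop7CovBlockGauss (sum_eq_sum_far_layer_lines update_update_eq_self)
open Summit.QuantumFields.YangMills.Theorems.Prop7CovRightInverse (iterate_shift_fibreSite_of_lt)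
open Summit.QuantumFields.YangMills.Theorems.Prop7BlockLineCount (sum_site_eq_sum_fibreSite)

variable {P : Params} {k : ℕ} {N : ℕ} [NeZero N]

/-- The `s`-th site of the `μ`-line started on the NEAR layer at `r̄ with r̄_μ ↦ 0` is `x_{r̄ with r̄_μ ↦ s}` (`s < L^k`). [cite: Balaban1984PropagatorsI, (1.18) p.20] -/
theorem iterate_shift_nearLayer (y : Site P k) (rbar : Fin P.d → Fin (P.L ^ k)) (μ : Fin P.d) (s : Fin (P.L ^ k)) :
    (fun z : Site P 0 => z.shift μ)^[(s : ℕ)] (Site.fibreSite 0 k y (Function.update rbar μ ⟨0, pow_pos P.L_pos k⟩))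
      = Site.fibreSite 0 k y (Function.update rbar μ s) := by
  have hlt : ((Function.update rbar μ ⟨0, pow_pos P.L_pos k⟩ μ : ℕ)) + (s : ℕ) < P.L ^ k := by
    simp only [Function.update_self]
    have := s.isLt
    omega
  rw [iterate_shift_fibreSite_of_lt y _ μ _ hlt, Function.update_idem]
  congr 2
  apply Fin.ext
  simp only [Function.update_self, Fin.val_mk, zero_add]

/-- ★★ **PER BLOCK AND DIRECTION: THE FAR-LAYER VALUES ARE PAID BY THE LINE TRACE**: for any site function `f` and a `U1`-valued background,
`Σ_{r̄_μ+1 = L^k} ‖f(x_r̄)‖² ≤ 2ℓ⁻¹·Σ_r ‖f(x_r)‖² + 2ℓ·Σ_r ‖R(V⟨x_r, μ⟩)f(x_r + e_μ) − f(x_r)‖²` (`ℓ = L^k`; ✓ `normSq_apply_le_line_trace` on each line from the near layer, summed; the lines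
partition the block). [cite: Balaban1984PropagatorsI, (1.18)-(1.21) pp.20-21; Balaban1985RegularSpaces, (1.1) p.76] -/
theorem sum_far_normSq_le_block {V : GaugeField P 0 (Matrix (Fin N) (Fin N) ℂ)ˣ} (hV : ∀ b, V b ∈ U1 (Matrix (Fin N) (Fin N) ℂ))
    (y : Site P k) (μ : Fin P.d) (f : Site P 0 → Matrix (Fin N) (Fin N) ℂ) :
    ∑ rbar ∈ univ.filter (fun r : Fin P.d → Fin (P.L ^ k) => (r μ : ℕ) + 1 = P.L ^ k), ‖f (Site.fibreSite 0 k y rbar)‖ ^ 2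
      ≤ 2 * ((P.L : ℝ) ^ k)⁻¹ * ∑ r : Fin P.d → Fin (P.L ^ k), ‖f (Site.fibreSite 0 k y r)‖ ^ 2
        + 2 * ((P.L : ℝ) ^ k) * ∑ r : Fin P.d → Fin (P.L ^ k), ‖conjR (V ⟨Site.fibreSite 0 k y r, μ⟩) (f ((Site.fibreSite 0 k y r).shift μ)) - f (Site.fibreSite 0 k y r)‖ ^ 2 := by
  have hℓ : 0 < P.L ^ k := pow_pos P.L_pos k
  have hcast : ((P.L ^ k : ℕ) : ℝ) = (P.L : ℝ) ^ k := by push_cast; rfl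
  -- per far point: the trace along its line from the near layer
  have hpt : ∀ rbar ∈ univ.filter (fun r : Fin P.d → Fin (P.L ^ k) => (r μ : ℕ) + 1 = P.L ^ k),
      ‖f (Site.fibreSite 0 k y rbar)‖ ^ 2
        ≤ 2 * ((P.L : ℝ) ^ k)⁻¹ * ∑ s : Fin (P.L ^ k), ‖f (Site.fibreSite 0 k y (Function.update rbar μ s))‖ ^ 2
          + 2 * ((P.L : ℝ) ^ k) * ∑ s : Fin (P.L ^ k), ‖conjR (V ⟨Site.fibreSite 0 k y (Function.update rbar μ s), μ⟩)
              (f ((Site.fibreSite 0 k y (Function.update rbar μ s)).shift μ)) - f (Site.fibreSite 0 k y (Function.update rbar μ s))‖ ^ 2 := by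
    intro rbar hrbar
    have hr : (rbar μ : ℕ) + 1 = P.L ^ k := (Finset.mem_filter.mp hrbar).2
    have h1 := normSq_apply_le_line_trace hV f (Site.fibreSite 0 k y (Function.update rbar μ ⟨0, pow_pos P.L_pos k⟩)) μ
      (t₀ := P.L ^ k - 1) (n := P.L ^ k) (by omega)
    -- the end of the line is `x_rbar`
    have hend : (fun z : Site P 0 => z.shift μ)^[P.L ^ k - 1] (Site.fibreSite 0 k y (Function.update rbar μ ⟨0, pow_pos P.L_pos k⟩)) = Site.fibreSite 0 k y rbar := by
      have := iterate_shift_nearLayer y rbar μ ⟨P.L ^ k - 1, Nat.sub_lt hℓ one_pos⟩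
      rw [Fin.val_mk] at this
      rw [this]
      have hval : (⟨P.L ^ k - 1, Nat.sub_lt hℓ one_pos⟩ : Fin (P.L ^ k)) = rbar μ := Fin.ext (by show P.L ^ k - 1 = (rbar μ : ℕ); omega)
      rw [hval, Function.update_eq_self]
    rw [hend, hcast, Finset.sum_range (fun s => ‖f ((fun z : Site P 0 => z.shift μ)^[s] (Site.fibreSite 0 k y (Function.update rbar μ ⟨0, pow_pos P.L_pos k⟩)))‖ ^ 2),
      Finset.sum_range (fun s => ‖conjR (V ⟨(fun z : Site P 0 => z.shift μ)^[s] (Site.fibreSite 0 k y (Function.update rbar μ ⟨0, pow_pos P.L_pos k⟩)), μ⟩)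
        (f (((fun z : Site P 0 => z.shift μ)^[s] (Site.fibreSite 0 k y (Function.update rbar μ ⟨0, pow_pos P.L_pos k⟩))).shift μ))
        - f ((fun z : Site P 0 => z.shift μ)^[s] (Site.fibreSite 0 k y (Function.update rbar μ ⟨0, pow_pos P.L_pos k⟩)))‖ ^ 2)] at h1
    simp only [iterate_shift_nearLayer] at h1
    exact h1
  refine (Finset.sum_le_sum hpt).trans (le_of_eq ?_)
  rw [Finset.sum_add_distrib, ← Finset.mul_sum, ← Finset.mul_sum,
    ← sum_eq_sum_far_layer_lines μ (fun r => ‖f (Site.fibreSite 0 k y r)‖ ^ 2),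
    ← sum_eq_sum_far_layer_lines μ (fun r => ‖conjR (V ⟨Site.fibreSite 0 k y r, μ⟩) (f ((Site.fibreSite 0 k y r).shift μ)) - f (Site.fibreSite 0 k y r)‖ ^ 2)]

/-- ★★★ **FAR-MASS, SUMMED OVER THE TORUS**: `Σ_y Σ_μ Σ_{r̄_μ+1 = L^k} ‖B⟨x_r̄, μ⟩‖² ≤ 2ℓ⁻¹·Σ_b‖B b‖² + 2ℓ·Σ_b ‖R(V_b)B(b + e_{μ_b}) − B(b)‖²` — the mass of `B` on the blocks' far layers is at most
`2ℓ⁻¹`× the total mass plus `2ℓ`× the longitudinal covariant gradient energy (px17 LOCATE §0.1 (F): `M_faces ≤ 2ℓ⁻¹M + 2ℓG_long`).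
[cite: Balaban1984PropagatorsI, (1.18)-(1.21) pp.20-21; Balaban1985RegularSpaces, (1.1) p.76; Balaban1985Variational, Prop. 7 p.299] -/
theorem sum_far_layer_mass_le (h : P.sitesPerDir 0 = P.L ^ k * P.sitesPerDir k) {V : GaugeField P 0 (Matrix (Fin N) (Fin N) ℂ)ˣ}
    (hV : ∀ b, V b ∈ U1 (Matrix (Fin N) (Fin N) ℂ)) (B : PBond P 0 → Matrix (Fin N) (Fin N) ℂ) :
    ∑ y : Site P k, ∑ μ : Fin P.d, ∑ rbar ∈ univ.filter (fun r : Fin P.d → Fin (P.L ^ k) => (r μ : ℕ) + 1 = P.L ^ k), ‖B ⟨Site.fibreSite 0 k y rbar, μ⟩‖ ^ 2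
      ≤ 2 * ((P.L : ℝ) ^ k)⁻¹ * ∑ b : PBond P 0, ‖B b‖ ^ 2
        + 2 * ((P.L : ℝ) ^ k) * ∑ b : PBond P 0, ‖conjR (V b) (B ⟨b.src.shift b.dir, b.dir⟩) - B b‖ ^ 2 := by
  calc ∑ y : Site P k, ∑ μ : Fin P.d, ∑ rbar ∈ univ.filter (fun r : Fin P.d → Fin (P.L ^ k) => (r μ : ℕ) + 1 = P.L ^ k), ‖B ⟨Site.fibreSite 0 k y rbar, μ⟩‖ ^ 2
      ≤ ∑ y : Site P k, ∑ μ : Fin P.d, (2 * ((P.L : ℝ) ^ k)⁻¹ * ∑ r : Fin P.d → Fin (P.L ^ k), ‖B ⟨Site.fibreSite 0 k y r, μ⟩‖ ^ 2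
          + 2 * ((P.L : ℝ) ^ k) * ∑ r : Fin P.d → Fin (P.L ^ k),
              ‖conjR (V ⟨Site.fibreSite 0 k y r, μ⟩) (B ⟨(Site.fibreSite 0 k y r).shift μ, μ⟩) - B ⟨Site.fibreSite 0 k y r, μ⟩‖ ^ 2) :=
        Finset.sum_le_sum fun y _ => Finset.sum_le_sum fun μ _ => sum_far_normSq_le_block hV y μ (fun z => B ⟨z, μ⟩)
    _ = 2 * ((P.L : ℝ) ^ k)⁻¹ * ∑ b : PBond P 0, ‖B b‖ ^ 2
          + 2 * ((P.L : ℝ) ^ k) * ∑ b : PBond P 0, ‖conjR (V b) (B ⟨b.src.shift b.dir, b.dir⟩) - B b‖ ^ 2 := by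
        rw [B10StarCount.sum_pbond (fun b : PBond P 0 => ‖B b‖ ^ 2),
          B10StarCount.sum_pbond (fun b : PBond P 0 => ‖conjR (V b) (B ⟨b.src.shift b.dir, b.dir⟩) - B b‖ ^ 2),
          sum_site_eq_sum_fibreSite h (fun x => ∑ μ : Fin P.d, ‖B ⟨x, μ⟩‖ ^ 2),
          sum_site_eq_sum_fibreSite h (fun x => ∑ μ : Fin P.d, ‖conjR (V ⟨x, μ⟩) (B ⟨x.shift μ, μ⟩) - B ⟨x, μ⟩‖ ^ 2)]
        simp only [Finset.sum_add_distrib, Finset.mul_sum]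
        congr 1 <;> (refine Finset.sum_congr rfl fun y _ => ?_) <;> rw [Finset.sum_comm]

end Summit.QuantumFields.YangMills.Theorems.Prop7FarLayerMassTrace

end
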